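import Summits.HodgeConjecture.HodgeConjecture.Theorems.Ring2AtlasSixfolds
import Literature.AlgebraicGeometry.Motives.AbelianVarietyProductDimProofs
import HarnessLib

/-!
# Ring 2 · atlas-2 (generation 8) — TYPED CELLS of the PRODUCT7-CENSUS rows (`g = 6, 7`, non-simple)

HONEST FRAMING: research route conditional on HC_CM; not a corollary; Q11.4-sentence-2 already refuted in dim ≥ 3.

Cell `pub-hodge-ring2`, seat `pub-hodge-ring2-atlas-2` (generation 8). Companion of `Ring2AtlasSixfolds`: the
PRODUCT7-CENSUS (`run/shared/lean/pub/pub-hodge-ring2/pub-hodge-ring2-atlas-2-g8/PRODUCT7-CENSUS.md`, AV-HODGE-ATLAS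
§24) classifies EVERY non-simple, non-CM complex abelian variety of dimension `≤ 7` by the interaction type of its
Hodge group, with two independent engines agreeing (A = closed form, B = brute-force Goursat couplings: 512 factor
pairs, 29 interacting, derived parts always independent, 33 clusters). Of the 35 resulting cells, 24 were already
catalogued; this file types the four new rows whose FIRST power carries exceptional Hodge classes and whose print
status is worth a kernel record. Shapes, ON-PATH lemmas (`HC_AV → cell`, `HodgeConjecture → cell`, kernel row
`HCAtDim g → cell`; `HC_AV` = `Theses.PadicSemiregularLift.HodgeAbelianVarieties`, item stmt-HodgeConjecture-1333, by
name) and conventions are those of `Ring2AtlasSixfolds`. `HC_CM` (= `Theses.RankFourFaces.CMAbelianHodge`, item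
stmt-HodgeConjecture-3052) is never re-declared and reaches none of these rows (no member is of CM type). Nothing in
this file asserts an open statement: the cells are `def`s, the theorems are implications.

ENGINE. `b_p = dim B^p(X^k) ⊗ ℂ` (Hodge-group invariants), `d_p = dim D^p(X^k) ⊗ ℂ` (divisor-generated part); every
row below is certified A1 = B (atlas-1's weight engine run on atlas-2's cell file versus atlas-2's engine B; 313
degree entries, 0 mismatches, `data/atlas/product7/DIFF-product7-newrows-*.md`). The Hodge groups are INPUTS: derived
part = product of the factors' derived Hodge groups, connected centre = Mumford–Tate hull of the joint central
cocharacter (Moonen–Zarhin 1999 §3 (3.1), (3.8) mechanism — the "k-line"; CELL INFERENCE where no printed statement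
covers the row). Typed classes are stated by endomorphisms `φ ≫ φ = -d` (an imaginary quadratic field `k = ℚ(√-d)`
inside `End⁰`), dimensions, simplicity and the degree of the endomorphism algebra; each docstring says which census
rows the typed class contains.

LOCATORS as in `Ring2AtlasSixfolds` (Moonen–Zarhin 1999 = arXiv math/9901113: (3.8) = [p0007 L55–59], §5 Case 2 =
[p0010 L91–98]); Floccari–Fu 2026 Thm. 1.2 = [corpus:paper:arxiv-2504.13607 p0003 L21–22] ("all powers of any abelian
fourfold of Weil type with discriminant 1"; definition p0003 L6: the `(2,2)` condition only, no simplicity);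
Abdulali 2012 Thm. 14 = [corpus:paper:arxiv-1203.4857 p0010].
-/

open CategoryTheory

namespace Summit.HodgeConjecture.HodgeConjecture.Ring2.Atlas

open Literature.AlgebraicGeometry Literature.AlgebraicGeometry.Motives
open Literature.AlgebraicGeometry.HodgeTheory
open Summit.HodgeConjecture.HodgeConjecture.Theses
open Summit.HodgeConjecture.HodgeConjecture.Ring2.ClassTargets

/-! ## §1 Row `g = 6`: `E_k² × Y₄/M`, `M` biquadratic — a NON-SIMPLE sixfold of Weil type `(3,3)` -/

/-- **OPEN CELL (g = 6, NEW ROW `g6.Ek2xY4_M.biquad`) — the Hodge conjecture for `E × E × Y` with `Y` a simple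
type-IV fourfold whose endomorphism algebra is a quartic CM field `M` (`IsQuarticFieldTypeIVFourfold`, signature
`{(2,0),(1,1)}`) containing `k = ℚ(√-d)`, and `E` an elliptic curve with CM by the same `k`.** A quartic CM field
with an imaginary quadratic subfield is biquadratic, `M = k k″ M₀`; both `k` and `k″` act on `T₀Y` with
multiplicities `(3,1)`, and the central cocharacter of `Y` has non-zero component on both lines `χ_k, χ_k″` of
`X_*(U_M) ⊗ ℚ` (census: `Hg(Y) = U_M(H¹)`, rank-2 centre; `E × Y` alone is Moonen–Zarhin (3.8), atlas-1 row
`g5.(g2)`, `B = D` on `X`). ENGINE (A1 = B): `X`: `b = [1,6,12,18,12,6,1]`, `d = [1,6,12,16,12,6,1]` — TWO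
exceptional classes in `B³(X)`, none elsewhere; `X²`: `b₃ - d₃ = 108` (exceptional in `p = 3..9`); `X³`:
`b₃ - d₃ = 1080` (`p = 3..15`). MECHANISM (CELL INFERENCE from the count `2 = [k:ℚ]`): letting `k` act on the two
curves through the conjugate embedding and on `Y` through `k ⊂ M`, `X` is an abelian SIXFOLD OF WEIL TYPE `(3,3)`
and `W_k = ∧⁶_k H¹(X,ℚ) ⊂ H^{0,2}(E²) ⊗ H^{3,1}(Y) ⊕ conj.` is Hodge-type-disjoint from `D³(X)`, so
`B³(X) = D³(X) ⊕ W_k` — Moonen–Zarhin's §5 Case 2 sixfold `E_k² × Y₄/k(3,1)` (catalogued `g6.E2xY4.(3,1)`) with the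
larger centre `M ⊋ k`. PRINT STATUS: `W_k` algebraic on the components of discriminant `-1` by Markman Thm. 1.5.1
(UNREFEREED; the discriminant of a product polarization is NOT derived here); refereed print: OPEN. KIND of `HC_CM`:
ABSENT. Reachable cell of route `SevenfoldWeilCensus` (`WeilSixfolds`, stmt-HodgeConjecture-2524, which quantifies
over ALL Weil-type sixfolds) GIVEN the product `k`-structure, which the kernel does not construct here.
[cite: MoonenZarhin1999LowDim, §3 (3.8) and §5 Case 2] [cite: Markman2025SecantWeil, Thm. 1.5.1]
[cite: MoonenZarhin1998WeilClasses, Criterion (4.1)] [status: open] -/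
@[conjecture] def HodgeCMEllipticSquaredTimesQuarticFieldFourfold : Prop :=
  ∀ (E Y : AbelianVariety ℂ) (φ : E ⟶ E) (ψ : Y ⟶ Y) (d : ℕ), 0 < d → E.dim = 1 → IsQuarticFieldTypeIVFourfold Y →
    φ ≫ φ = -(d • 𝟙 E) → ψ ≫ ψ = -(d • 𝟙 Y) →
    HodgeConjectureFor ((E.prod E).prod Y).dim ((E.prod E).prod Y).X

/-- ON-PATH: a case of `HC_AV`. [cite: Deligne2000, §1] -/
theorem hodgeCMEllipticSquaredTimesQuarticFieldFourfold_of_hodgeAbelianVarieties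
    (h : PadicSemiregularLift.HodgeAbelianVarieties) : HodgeCMEllipticSquaredTimesQuarticFieldFourfold :=
  fun _ _ _ _ _ _ _ _ _ _ ↦ h _

/-- ON-PATH: a case of the summit. [cite: Deligne2000, §1] -/
theorem hodgeCMEllipticSquaredTimesQuarticFieldFourfold_of_hodgeConjecture (h : _root_.HodgeConjecture) :
    HodgeCMEllipticSquaredTimesQuarticFieldFourfold :=
  hodgeCMEllipticSquaredTimesQuarticFieldFourfold_of_hodgeAbelianVarieties (Ring2.Deform.HC_AV_of_hodgeConjecture h)

/-- Dimension bookkeeping: `dim (E × E × Y) = 6`. [folklore] -/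
theorem dim_prod_prod_of_one_four {E Y : AbelianVariety ℂ} (hE : E.dim = 1) (hY : Y.dim = 4) :
    ((E.prod E).prod Y).dim = 6 := by
  rw [AbelianVariety.dim_prod, AbelianVariety.dim_prod, hE, hY]

/-- ON-PATH inside the kernel frame: a case of the row `HCAtDim 6`. [folklore] -/
theorem hodgeCMEllipticSquaredTimesQuarticFieldFourfold_of_hcAtDim_six (h : HCAtDim 6) :
    HodgeCMEllipticSquaredTimesQuarticFieldFourfold :=
  fun _ _ _ _ _ _ hE hY _ _ ↦ h _ (dim_prod_prod_of_one_four hE hY.1)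

/-! ## §2 Row `g = 7`: `E_k³ × Y₄/M` -/

/-- **OPEN CELL (g = 7, NEW ROW `g7.Ek3xY4_M.biquad`) — the Hodge conjecture for `E × (E × E × Y)` with `E`, `Y`, `k`
as in §1.** ENGINE (A1 = B): `X`: `b = [1,11,30,54,54,30,11,1]`, `d = [1,11,30,48,48,30,11,1]` — six exceptional
dimensions in `B³` and six in `B⁴`; `X²`: `b₃ - d₃ = 270` (exceptional in `p = 3..11`). CELL INFERENCE (from the
counts `6 = 3·[k:ℚ]` in both degrees, not a tree fact): `B³(X) ⊗ ℂ` is spanned over `D³` by the pull-backs of the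
Weil classes `W_k` of the three sub-sixfolds `E_i × E_j × Y` of §1, and `B⁴` by their products with the point classes
of the remaining curve — so `HC(X)` would follow from §1 for those sixfolds (pull-backs and cup products of
algebraic classes are algebraic); no member is of Weil type (odd dimension). PRINT STATUS: OPEN (the sub-sixfolds as
in §1). KIND of `HC_CM`: ABSENT.
[cite: MoonenZarhin1999LowDim, §3 (3.8) and §5 Case 2] [cite: Markman2025SecantWeil, Thm. 1.5.1] [status: open] -/
@[conjecture] def HodgeCMEllipticCubedTimesQuarticFieldFourfold : Prop :=
  ∀ (E Y : AbelianVariety ℂ) (φ : E ⟶ E) (ψ : Y ⟶ Y) (d : ℕ), 0 < d → E.dim = 1 → IsQuarticFieldTypeIVFourfold Y →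
    φ ≫ φ = -(d • 𝟙 E) → ψ ≫ ψ = -(d • 𝟙 Y) →
    HodgeConjectureFor (E.prod ((E.prod E).prod Y)).dim (E.prod ((E.prod E).prod Y)).X

/-- ON-PATH: a case of `HC_AV`. [cite: Deligne2000, §1] -/
theorem hodgeCMEllipticCubedTimesQuarticFieldFourfold_of_hodgeAbelianVarieties
    (h : PadicSemiregularLift.HodgeAbelianVarieties) : HodgeCMEllipticCubedTimesQuarticFieldFourfold :=
  fun _ _ _ _ _ _ _ _ _ _ ↦ h _

/-- ON-PATH: a case of the summit. [cite: Deligne2000, §1] -/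
theorem hodgeCMEllipticCubedTimesQuarticFieldFourfold_of_hodgeConjecture (h : _root_.HodgeConjecture) :
    HodgeCMEllipticCubedTimesQuarticFieldFourfold :=
  hodgeCMEllipticCubedTimesQuarticFieldFourfold_of_hodgeAbelianVarieties (Ring2.Deform.HC_AV_of_hodgeConjecture h)

/-- ON-PATH inside the kernel frame: a case of the row `HCAtDim 7`. [folklore] -/
theorem hodgeCMEllipticCubedTimesQuarticFieldFourfold_of_hcAtDim_seven (h : HCAtDim 7) :
    HodgeCMEllipticCubedTimesQuarticFieldFourfold :=
  fun E Y _ _ _ _ hE hY _ _ ↦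
    h _ (show (E.prod ((E.prod E).prod Y)).dim = 7 by
      rw [AbelianVariety.dim_prod, dim_prod_prod_of_one_four hE hY.1, hE])

/-! ## §3 Row `g = 7`: `Y₃ × Z₃ × E_k` — a unitary threefold, a CM threefold and a CM curve on ONE `k`-line -/

/-- **OPEN CELL (g = 7, NEW ROW `g7.Y3xZ3xEk/k`) — the Hodge conjecture for `Y × Z × E` with `Y` a simple threefold
whose endomorphism algebra is `k = ℚ(√-d)` (multiplicities `(2,1)`), `Z` a simple threefold with complex
multiplication by a sextic CM field containing `k`, and `E` an elliptic curve with CM by `k`.** Census: the three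
central cocharacters lie on one `k`-line, the joint centre has rank `3 = rank Hg(Z)` against `1 + 3 + 1`, derived
part `SU(2,1)`; the sub-products are Moonen–Zarhin (a1) (`Y × E`, Weil fourfold), the catalogued sixfold
`g6.Y3xZ3CM/k` (`Y × Z`) and the CM fourfold `Z × E` (of Weil type, `k` acting `(0,1)+(2,1) = (2,2)`). ENGINE
(A1 = B): `X`: `b = [1,5,15,25,25,15,5,1]`, `d = [1,5,11,15,15,11,5,1]` — exceptional dimensions `4, 10, 10, 4` in
`p = 2..5`; `X²`: `b₂ - d₂ = 48` (`p = 2..12`). PRINT STATUS: `B²(X)`: the 4 exceptional dimensions are the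
pull-backs of the Weil classes of the two Weil-type `(2,2)` sub-fourfolds `Y × E` and `Z × E` (`2 + 2`, CELL
INFERENCE from the count), both algebraic for every `k` by Floccari–Fu 2026 Thm. 1.2 (REFEREED; any Weil-type fourfold
of discriminant `1`, a product polarization realising discriminant `1` — atlas-1's DERIVED remark under `g4.(a1)`), so
the Hodge conjecture for `X` in codimensions `2` and `5` is KNOWN in print; `B³`, `B⁴` (divisor × Weil products,
the `B³`-classes of `Y × Z` — discriminant `-1` components by Markman Thm. 1.5.1, UNREFEREED — and classes using all
three factors): OPEN. KIND of `HC_CM`: ABSENT (`Z` is CM, `X` is not). For `k = ℚ(i), ℚ(√-3)` the sub-product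
`Y × E` is also covered by Abdulali 2012 Thm. 14.
[cite: MoonenZarhin1999LowDim, §2 (2.3) and §3 (3.8)] [cite: FloccariFu2026, Theorem 1.2]
[cite: Markman2025SecantWeil, Thm. 1.5.1] [cite: Abdulali2012TateTwistsIV, Thm. 14] [status: open] -/
@[conjecture] def HodgeUnitaryThreefoldCMThreefoldCMElliptic : Prop :=
  ∀ (Y Z E : AbelianVariety ℂ) (ψ : Y ⟶ Y) (χ : Z ⟶ Z) (φ : E ⟶ E) (d : ℕ), 0 < d →
    Y.dim = 3 → Y.IsSimple → Module.finrank ℚ Y.endAlgebra = 2 →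
    Z.dim = 3 → Z.IsSimple → IsField Z.endAlgebra → Module.finrank ℚ Z.endAlgebra = 6 → E.dim = 1 →
    ψ ≫ ψ = -(d • 𝟙 Y) → χ ≫ χ = -(d • 𝟙 Z) → φ ≫ φ = -(d • 𝟙 E) →
    HodgeConjectureFor ((Y.prod Z).prod E).dim ((Y.prod Z).prod E).X

/-- ON-PATH: a case of `HC_AV`. [cite: Deligne2000, §1] -/
theorem hodgeUnitaryThreefoldCMThreefoldCMElliptic_of_hodgeAbelianVarieties
    (h : PadicSemiregularLift.HodgeAbelianVarieties) : HodgeUnitaryThreefoldCMThreefoldCMElliptic :=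
  fun _ _ _ _ _ _ _ _ _ _ _ _ _ _ _ _ _ _ _ ↦ h _

/-- ON-PATH: a case of the summit. [cite: Deligne2000, §1] -/
theorem hodgeUnitaryThreefoldCMThreefoldCMElliptic_of_hodgeConjecture (h : _root_.HodgeConjecture) :
    HodgeUnitaryThreefoldCMThreefoldCMElliptic :=
  hodgeUnitaryThreefoldCMThreefoldCMElliptic_of_hodgeAbelianVarieties (Ring2.Deform.HC_AV_of_hodgeConjecture h)

/-- ON-PATH inside the kernel frame: a case of the row `HCAtDim 7`. [folklore] -/
theorem hodgeUnitaryThreefoldCMThreefoldCMElliptic_of_hcAtDim_seven (h : HCAtDim 7) :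
    HodgeUnitaryThreefoldCMThreefoldCMElliptic :=
  fun Y Z E _ _ _ _ _ hY _ _ hZ _ _ _ hE _ _ _ ↦
    h _ (show ((Y.prod Z).prod E).dim = 7 by rw [AbelianVariety.dim_prod, AbelianVariety.dim_prod, hY, hZ, hE])

/-! ## §4 Row `g = 7`: `Y₃² × E_k` — the only multiplicity row; KNOWN in print -/

/-- **CELL (g = 7, NEW ROW `g7.Y3sqxEk`, KNOWN IN PRINT) — the Hodge conjecture for `Y × Y × E` with `Y` a simple
threefold whose endomorphism algebra is `k = ℚ(√-d)` and `E` an elliptic curve with CM by `k`.** The only row of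
dimension `≤ 7` with a repeated non-elliptic factor that interacts: `Hg(Y² × E) = Hg(Y × E) =
{(g,u) ∈ U(2,1) × U(1) : det g = u^{±1}}` (Moonen–Zarhin (a1)) acting diagonally. ENGINE (A1 = B): `X`:
`b = [1,5,22,42,42,22,5,1]`, `d = [1,5,14,30,30,14,5,1]` — `8, 12, 12, 8` exceptional dimensions in `p = 2..5`, the
`B²` ones being the pull-backs of `W_k(Y × E)` along `(y₁,y₂,e) ↦ (a y₁ + b y₂, e)` (`Sym³` of the multiplicity plane
and its conjugate); `X²`: `b₂ - d₂ = 80`. PRINT STATUS: KNOWN for every `k` and every power — `Xⁿ` is a direct factor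
of `(Y × E)^{2n}` (elementary) and the Hodge conjecture for all powers of the Weil fourfold `Y × E` with a
discriminant-1 (product) polarization is Floccari–Fu 2026 Thm. 1.2 (REFEREED) [corpus:paper:arxiv-2504.13607 p0003
L21–22]; for `k = ℚ(i), ℚ(√-3)` earlier by Abdulali 2012 Thm. 14. In the kernel the discharge would go through atlas-1's
`HodgePowersOfDiscOneWeilFourfold` (`hodgePowersOfDiscOneWeilFourfold_of_floccariFu`) plus descent to a direct
factor; the hyperbolic product class is an input the kernel does not construct, so only the ON-PATH lemmas are
recorded. KIND of `HC_CM`: ABSENT.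
[cite: MoonenZarhin1999LowDim, §2 (2.3) and Thm. 0.1 (a1)] [cite: FloccariFu2026, Theorem 1.2]
[cite: Abdulali2012TateTwistsIV, Thm. 14] [status: known in print (refereed); kernel: on path only] -/
@[conjecture] def HodgeUnitaryThreefoldSquaredTimesCMElliptic : Prop :=
  ∀ (Y E : AbelianVariety ℂ) (ψ : Y ⟶ Y) (φ : E ⟶ E) (d : ℕ), 0 < d →
    Y.dim = 3 → Y.IsSimple → Module.finrank ℚ Y.endAlgebra = 2 → E.dim = 1 →
    ψ ≫ ψ = -(d • 𝟙 Y) → φ ≫ φ = -(d • 𝟙 E) →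
    HodgeConjectureFor ((Y.prod Y).prod E).dim ((Y.prod Y).prod E).X

/-- ON-PATH: a case of `HC_AV`. [cite: Deligne2000, §1] -/
theorem hodgeUnitaryThreefoldSquaredTimesCMElliptic_of_hodgeAbelianVarieties
    (h : PadicSemiregularLift.HodgeAbelianVarieties) : HodgeUnitaryThreefoldSquaredTimesCMElliptic :=
  fun _ _ _ _ _ _ _ _ _ _ _ _ ↦ h _

/-- ON-PATH: a case of the summit. [cite: Deligne2000, §1] -/
theorem hodgeUnitaryThreefoldSquaredTimesCMElliptic_of_hodgeConjecture (h : _root_.HodgeConjecture) :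
    HodgeUnitaryThreefoldSquaredTimesCMElliptic :=
  hodgeUnitaryThreefoldSquaredTimesCMElliptic_of_hodgeAbelianVarieties (Ring2.Deform.HC_AV_of_hodgeConjecture h)

/-- ON-PATH inside the kernel frame: a case of the row `HCAtDim 7`. [folklore] -/
theorem hodgeUnitaryThreefoldSquaredTimesCMElliptic_of_hcAtDim_seven (h : HCAtDim 7) :
    HodgeUnitaryThreefoldSquaredTimesCMElliptic :=
  fun Y E _ _ _ _ hY _ _ hE _ _ ↦
    h _ (show ((Y.prod Y).prod E).dim = 7 by rw [AbelianVariety.dim_prod, AbelianVariety.dim_prod, hY, hE])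

/-! ## §5 The generation-8 cells in one conjunction, on path -/

/-- All four PRODUCT7 cells follow from `HC_AV` (item stmt-HodgeConjecture-1333 by name). [cite: Deligne2000, §1] -/
theorem atlasTwoProductCells_of_hodgeAbelianVarieties (h : PadicSemiregularLift.HodgeAbelianVarieties) :
    HodgeCMEllipticSquaredTimesQuarticFieldFourfold ∧ HodgeCMEllipticCubedTimesQuarticFieldFourfold ∧
      HodgeUnitaryThreefoldCMThreefoldCMElliptic ∧ HodgeUnitaryThreefoldSquaredTimesCMElliptic :=
  ⟨hodgeCMEllipticSquaredTimesQuarticFieldFourfold_of_hodgeAbelianVarieties h,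
    hodgeCMEllipticCubedTimesQuarticFieldFourfold_of_hodgeAbelianVarieties h,
    hodgeUnitaryThreefoldCMThreefoldCMElliptic_of_hodgeAbelianVarieties h,
    hodgeUnitaryThreefoldSquaredTimesCMElliptic_of_hodgeAbelianVarieties h⟩

/-- All four PRODUCT7 cells follow from the summit statement. [cite: Deligne2000, §1] -/
theorem atlasTwoProductCells_of_hodgeConjecture (h : _root_.HodgeConjecture) :
    HodgeCMEllipticSquaredTimesQuarticFieldFourfold ∧ HodgeCMEllipticCubedTimesQuarticFieldFourfold ∧
      HodgeUnitaryThreefoldCMThreefoldCMElliptic ∧ HodgeUnitaryThreefoldSquaredTimesCMElliptic :=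
  atlasTwoProductCells_of_hodgeAbelianVarieties (Ring2.Deform.HC_AV_of_hodgeConjecture h)

/-- The four cells follow from the two kernel rows `HCAtDim 6` and `HCAtDim 7`. [folklore] -/
theorem atlasTwoProductCells_of_hcAtDim (h₆ : HCAtDim 6) (h₇ : HCAtDim 7) :
    HodgeCMEllipticSquaredTimesQuarticFieldFourfold ∧ HodgeCMEllipticCubedTimesQuarticFieldFourfold ∧
      HodgeUnitaryThreefoldCMThreefoldCMElliptic ∧ HodgeUnitaryThreefoldSquaredTimesCMElliptic :=
  ⟨hodgeCMEllipticSquaredTimesQuarticFieldFourfold_of_hcAtDim_six h₆,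
    hodgeCMEllipticCubedTimesQuarticFieldFourfold_of_hcAtDim_seven h₇,
    hodgeUnitaryThreefoldCMThreefoldCMElliptic_of_hcAtDim_seven h₇,
    hodgeUnitaryThreefoldSquaredTimesCMElliptic_of_hcAtDim_seven h₇⟩

end Summit.HodgeConjecture.HodgeConjecture.Ring2.Atlas
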